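import Summits.HubbardSuperconductivity.HubbardSuperconductivity.Theses.PolyaSchurPairBoson
import Literature.MathematicalPhysics.QuantumLattice.PlaquettePairCouplings
import HarnessLib

/-!
# Crux `DressAnyFilling` (stmt-HubbardSuperconductivity-10291; route `PolyaSchurPairBoson`, rank 5)
# — BIRTH SKELETON `Lines/birth.lean` (BC3)

THE CRUX (fixed; `Theses/PolyaSchurPairBoson.lean`, decl `DressAnyFilling`, concluded BY NAME below, not restated):
`EasyPlaneCondensate → AnchorOrder` — RP-free easy-plane condensation of the two-dimensional hard-core Bose gas
(`xxzHamiltonian 1 (torusGraph 2 M) (-1) Δ`, every `Δ ∈ (-1,0]`, every filling `ρ ∈ (0,1/2]`) implies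
`d_{x²-y²}` pair-field order `re ⟨Δ_d† Δ_d⟩ ≥ c(t') L⁴` of EVERY normalised `(N_L, S^z = 0)`-sector ground state
of the checkerboard Hubbard torus `H_L(t',U) = hamiltonian G_intra 1 U + hamiltonian G_inter t' 0` at SOME
`(U, δ)`, for all small `t'`, eventually in `L ∈ 4ℕ`.

THE LINE = the route's own two-layer plan for this node (route header, TWO-LAYER PLAN:
`DressAnyFilling ⇐ KineticGlueInWindow → SchriefferWolffPlaquette → DressingStability`), typed over the
definition request that has since LANDED (`Literature/…/PlaquettePairCouplings.lean`: `plaquettePairCouplings U`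
with fields `E, pairBinding, pairExclusion, J, V, μ, c` and `ΔEff = -V/(2J)`), cut at its three natural joints.
The four `def`s `PlaquetteData`, `PlaquetteDictionary`, `BosonCondensateAt`, `AnchorAt` are STATEMENT
ABBREVIATIONS only (verbatim sub-formulas of the route decls; no mathematical content, nothing is assumed):

1. `stub_kineticGlueInWindow : ∃ U > 0, PlaquetteData U` — CERTIFIED PLAQUETTE DATA (finite-dimensional:
   the 256-dimensional one-plaquette problem and Kato's two-plaquette kernel; certified exact diagonalisation /
   interval arithmetic at ONE coupling, e.g. `U = 2`; size M–L): (W1) the `O(t'²)` pair-boson couplings lie in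
   the repulsive interior of the Pólya–Schur window, `0 < J(U)`, `0 ≤ V(U) < 2 J(U)` (route numbers,
   uncertified: `V/2J = 0.986, 0.993` at `U = 1, 2`; `= 1` exactly at `U_s ≈ 2.7`); (W2) the `B₁g` selection
   rule `c(U) = ⟨2h| Δ_d^{(R)} |0h⟩ > 0`; (W3) the block manifold {every plaquette with `2` or `4` electrons}
   is the STRICT minimum of the decoupled plaquettes at every admissible charge — pair binding, pair exclusion,
   no trions AND the charge-gap side, as the strict chord condition `(4-n)E(2e) + (n-2)E(4e) < 2E(ne)`,
   `n ∈ {0,1,3,5,6,7,8}`; (W4) the `(4,0)` and `(2,0)` plaquette ground states are unique up to phase;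
   (W5) they are singlets strictly below the other `S^z` sectors of their charge. WHY IT MIGHT FAIL: the 1 %
   margin of (W1) (the route's own kill criterion: `V ≥ 2J` on all of `(0, U_s)` closes the route); (W3)–(W5)
   hold with margins `O(U)`, `O(1)` (Lieb 1989 at half filling) and are certification chores.
2. `stub_plaquetteDictionary : ∀ U > 0, PlaquetteData U → PlaquetteDictionary U` — SECOND-ORDER
   SCHRIEFFER–WOLFF = XXZ(Δ_eff) EXACTLY (the route's `SchriefferWolffPlaquette`, its exact finite-dimensional
   half; size L): the even-parity product embedding `Φ` (boson = hole pair = up spin; intrinsic second-quantised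
   products `Π_R P_R† |vac⟩`, so no Jordan–Wigner frustration) maps `N_b` bosons into the electron sector
   `(L² - 2N_b, S^z = 0)` and onto the `E₀(N_b)` eigenspace of `H_in`, which by (W3)–(W5) IS the sector ground
   space (lower bound: sum the chord inequality over plaquettes; exhaustion: equality forces charges in `{2,4}`,
   then `S^z_R = 0` by (W5), then the two singlets by (W4)); only bond pairs on one plaquette pair survive in
   `T S T` (odd-charge defects must be repaired), each contributing the two-plaquette kernel `plaquetteKernel U`
   (vertical bonds by the diagonal reflection, using (W4)); its entries ARE `-J`, `V`, `μ` by the definition of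
   `plaquettePairCouplings`, and `-J(b†b' + h.c.) + V n n' = 2J[-(SˣSˣ + SʸSʸ) - Δ_eff SᶻSᶻ] + (V/2)(Sᶻ + Sᶻ') +
   V/4`, the one-body terms summing to a constant on the regular plaquette torus at fixed `N_b`; finally
   `Φᴴ Δ_d Φ = c(U) Σ_R S⁺_R` because inter-plaquette and intra-`|2h⟩` pieces of `Δ_d` leave the manifold.
   WHY IT MIGHT FAIL: only by a convention slip (inter-cluster Jordan–Wigner sign inside `interClusterKernel`,
   whose identification with the two-cluster `secondOrderEffective` is deferred in the Literature file; the
   `M = 2` double-bond degeneracy is excluded by `L ≥ 8`); it is bookkeeping over `FermionEmbedding`-type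
   tensor structure, provable with effort.
3. `stub_dressingStability : ∀ U > 0, PlaquetteData U → PlaquetteDictionary U → BosonCondensateAt U →
   ∃ δ ∈ (0,1/2), AnchorAt U δ` — DRESSING (the route's `DressingStability`; the OPEN, load-bearing stub; size
   XL / open-problem): at a coupling with the plaquette data and the dictionary, easy-plane condensation of the
   XXZ torus AT THE LOCKED-IN ANISOTROPY `Δ_eff(U)` and every filling `ρ ∈ (0, 1/2]` implies the anchor at
   `(U, δ)` for SOME doping `δ ∈ (0, 1/2)` (the prover takes `δ ≤ 1/4`, boson filling `2δ ≤ 1/2`): the order of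
   the `O(t'²)` gas `2J t'² · XXZ(Δ_eff)` survives the `O(t'⁴)` Schrieffer–Wolff remainder for `t' < t₀(U)`
   and projects onto `Δ_d` through `|c(U)|² > 0`, for EVERY sector ground state, eventually in `L ∈ 4ℕ`.
   WHY IT MIGHT FAIL (= the crux's): gapless `U(1)` order of the `t'²` gas must survive an extensive `O(t'⁴)`
   perturbation uniformly in `L` — no LRO-stability tool off reflection positivity (Datta–Fernández–Fröhlich
   1996 needs a gap; Koma–Tasaki 1994 on the obstruction side); `t₀(U) ≲ Δ_pb(U) → 0` as `U → 0`.

COMPOSITION `DressAnyFilling_of : Sig.stub₁ → Sig.stub₂ → Sig.stub₃ → PolyaSchurPairBoson.DressAnyFilling` (REAL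
proof, no `sorry`; the `Sig.stub_*` are syntactic twins of the stub statements keyed by the stub names so that
`#h21_check_skeleton` admits them as hypotheses by name) and `DressAnyFilling_skeleton : DressAnyFilling :=
DressAnyFilling_of stub₁ stub₂ stub₃` (the stubs themselves feed it): take the coupling `U` of stub 1; ITS
WINDOW INEQUALITIES PUT THE LOCK-IN INSIDE THE EASY-PLANE INTERVAL, `Δ_eff(U) = -V/(2J) ∈ (-1, 0]` (`0 < J`,
`0 ≤ V < 2J`), so the crux hypothesis `EasyPlaneCondensate` may be instantiated at `Δ = Δ_eff(U)` and every
`ρ ∈ (0, 1/2]`, giving `BosonCondensateAt U`; stub 2 supplies the dictionary at `U`; stub 3 returns `δ` and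
`AnchorAt U δ`, which is the crux's consequent by `⟨U, hU, δ, hδ, ·⟩`.

AUDIT (lean check --json, 2026-08-17): rc 0, errors [], sorries 3 = the three `stub_*` theorems, zero
elsewhere; `#print axioms DressAnyFilling_of` = [propext, Classical.choice, Quot.sound]. BC3 PROBES (folder
`bc/probe_{1,2,3}_{crux,summit}.lean`): for each stub `k`, `Sigₖ → DressAnyFilling` and
`Sigₖ → HubbardSuperconductivity` by `first | exact? | simpa | aesop`, and separately by `exact?`,
`intro h; simpa using h`, `simpa [all defs unfolded]`, `aesop`, `unfold …; aesop` — ALL FAIL (36/36);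
no stub is cheaply the crux or the summit (stub 3 needs the data and the dictionary at the SAME `U`; the crux
needs the condensate at EVERY `Δ ∈ (-1,0]`, stub 3 only at `Δ_eff(U)`).

DISPROOF USED: none exists — `ledger crux ls stmt-HubbardSuperconductivity-10291`: no workfiles (no `Disproof.lean`, no
`Negative/` lemma) on 2026-08-17; `ledger negatives --problem HubbardSuperconductivity` is not touched by any stub
(no stub asserts LRO of a named model outright; stub 3 is conditional on the boson condensate).

Sources: H. Yao, W.-F. Tsai, S. A. Kivelson, PRB 76 (2007) 161104(R) = arXiv:0706.0761, eqs. (1)–(2), p. 4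
[YaoTsaiKivelson2007]; W.-F. Tsai, S. A. Kivelson, PRB 73 (2006) 214510, Table I, App. A [TsaiKivelson2006];
E. Altman, A. Auerbach, PRB 65 (2002) 104508 §II.D [AltmanAuerbach2002]; T. Kato (1966) II-§2.2 [Kato1966];
E. H. Lieb, PRL 62 (1989) 1201 [Lieb1989]; N. Datta, R. Fernández, J. Fröhlich, J. Stat. Phys. 84 (1996) 455
[DattaFernandezFrohlich1996]; T. Koma, H. Tasaki, J. Stat. Phys. 76 (1994) 745 [KomaTasaki1994]. No Literature
fact is introduced; the local `def`s are statement abbreviations and the three `Sig.stub_*` twins.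
-/

noncomputable section

-- `dupNamespace`: the summit and the problem are both named `HubbardSuperconductivity` (layout D-0022)
set_option linter.dupNamespace false

namespace Summit.HubbardSuperconductivity.HubbardSuperconductivity.Cruxes.DressAnyFilling.Birth

open scoped BigOperators Matrix ComplexOrder Classical
open Matrix Finset
open Literature.Probability.LatticeModels Literature.MathematicalPhysics.QuantumLattice

/-! ## Statement abbreviations (no mathematical content; verbatim sub-formulas of the route decls) -/

/-- **PLAQUETTE DATA at the coupling `U`** (the conclusion of stub 1 and the standing hypothesis of
stubs 2–3; every clause is a finite-dimensional fact about ONE `2 × 2` Hubbard plaquette at `t = 1`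
and the two-plaquette second-order kernel, to be certified by exact diagonalisation / interval
arithmetic): (W1) `0 < J(U)`, `0 ≤ V(U) < 2J(U)` — the `O(t'²)` pair-boson couplings lie in the
repulsive interior of the Pólya–Schur / easy-plane window, i.e. `Δ_eff(U) = -V/(2J) ∈ (-1, 0]`;
(W2) `0 < c(U) = ⟨2h| Δ_d^{(R)} |0h⟩` (`B₁g` selection rule); (W3) pair binding, pair exclusion
and the full STRICT CHORD CONDITION on the plaquette charge: for every electron number
`n ∈ {0,…,8} ∖ {2,4}`, `(4-n)·E(2e) + (n-2)·E(4e) < 2·E(n e)` (`E(n e) = groundEnergyAt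
plaquetteGraph 1 U n`; `n = 3` is pair binding, `n = 0` pair exclusion, `n = 1` no trions,
`n = 5, 6` the charge-gap side `2E(5e)+E(2e) > 3E(4e)`, `E(6e)+E(2e) > 2E(4e)`) — exactly the
statement that the configurations with every plaquette carrying `2` or `4` electrons are the STRICT
minimisers of the decoupled plaquettes at every admissible total charge; (W4) the `(N,S^z) = (4,0)`
and `(2,0)` plaquette ground states are unique up to phase; (W5) they are singlets lying strictly
below the `S^z ≠ 0` sectors of the same charge. Tsai–Kivelson 2006, Table I, App. A;
Yao–Tsai–Kivelson 2007, eq. (2), p. 4; Lieb 1989 (W4–W5 at half filling). [folklore] -/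
def PlaquetteData (U : ℝ) : Prop :=
  (0 < (plaquettePairCouplings U).J ∧ 0 ≤ (plaquettePairCouplings U).V ∧
      (plaquettePairCouplings U).V < 2 * (plaquettePairCouplings U).J) ∧
  0 < (plaquettePairCouplings U).c ∧
  (0 < (plaquettePairCouplings U).pairBinding ∧ 0 < (plaquettePairCouplings U).pairExclusion ∧
    ∀ n : ℕ, n ≤ 8 → n ≠ 2 → n ≠ 4 →
      (4 - (n : ℝ)) * groundEnergyAt plaquetteGraph 1 U 2 + ((n : ℝ) - 2) * groundEnergyAt plaquetteGraph 1 U 4 <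
        2 * groundEnergyAt plaquetteGraph 1 U n) ∧
  (∀ φ₁ φ₂ : Fock (Orb PlaquetteSite), IsGroundStateInSector (plaquetteHamiltonian U) 4 0 φ₁ →
    IsGroundStateInSector (plaquetteHamiltonian U) 4 0 φ₂ → ∃ a : ℂ, φ₂ = a • φ₁) ∧
  (∀ φ₁ φ₂ : Fock (Orb PlaquetteSite), IsGroundStateInSector (plaquetteHamiltonian U) 2 0 φ₁ →
    IsGroundStateInSector (plaquetteHamiltonian U) 2 0 φ₂ → ∃ a : ℂ, φ₂ = a • φ₁) ∧
  (∀ m : ℝ, m = 1 ∨ m = -1 ∨ m = 2 ∨ m = -2 →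
    (plaquetteHamiltonian U).minEnergyOn (szSector 4 0) < (plaquetteHamiltonian U).minEnergyOn (szSector 4 m)) ∧
  (∀ m : ℝ, m = 1 ∨ m = -1 →
    (plaquetteHamiltonian U).minEnergyOn (szSector 2 0) < (plaquetteHamiltonian U).minEnergyOn (szSector 2 m))

/-- **THE PLAQUETTE-BOSON DICTIONARY at `U` to second order** (conclusion of stub 2): for every side
`L = 2M ≥ 8` with `4 ∣ L` there is an isometry `Φ` from the `S = ½` space of the `M × M` plaquette
torus (up spin at `R` = one hole pair on plaquette `R`) into the Fock space of the `L × L` torus with: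
(a) the `N_b`-boson sector goes into the electron sector `(L² - 2N_b, S^z = 0)` and (b) into the
`E₀(N_b) = (M² - N_b)E(0h) + N_b E(2h)` eigenspace of the intra-plaquette Hamiltonian
`H_in = hamiltonian G_intra 1 U`; (c) `E₀(N_b)` is the sector ground energy of `H_in` and its sector
eigenspace is exhausted by `Φ`; (d) in every boson sector Kato's second-order kernel of the
inter-plaquette hopping `T = hamiltonian G_inter 1 0` pulls back to the XXZ model at the lock-in
anisotropy: `⟨Φφ', T S(E₀) T Φφ⟩ = -⟨φ', (2J(U)·xxzHamiltonian 1 (torusGraph 2 M) (-1) Δ_eff(U) +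
k(N_b)) φ⟩` (`S = reducedResolvent = (H_in - E₀)⁻¹(1-P)`, the physicists' `-(E₀ - H_in)⁻¹`, whence
the sign; Yao–Tsai–Kivelson's `-J(b†b' + h.c.) + V n n'` bond by bond, fields constant at fixed
`N_b`); (e) the summit's pair field pulls back to the boson creator, `Φᴴ Δ_d Φ = c(U) Σ_R S⁺_R`.
Tsai–Kivelson 2006, App. A (A1); Yao–Tsai–Kivelson 2007, eq. (2); Kato 1966, II-§2.2 (2.20).
[folklore] -/
def PlaquetteDictionary (U : ℝ) : Prop :=
  ∀ (L M : ℕ) [NeZero L] [NeZero M], L = 2 * M → 8 ≤ L → 4 ∣ L →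
    let C := plaquettePairCouplings U;
    let Hin := hamiltonian ((fermionTorusGraph 2 L) \ SimpleGraph.comap
      (fun x : FermionTorus 2 L => fun i : Fin 2 => ((ofLex x) i : ℕ) / 2) ⊤) 1 U;
    let T := hamiltonian ((fermionTorusGraph 2 L) ⊓ SimpleGraph.comap
      (fun x : FermionTorus 2 L => fun i : Fin 2 => ((ofLex x) i : ℕ) / 2) ⊤) 1 0;
    let E₀ : ℕ → ℝ := fun Nb => ((M : ℝ) ^ 2 - (Nb : ℝ)) * C.E 0 + (Nb : ℝ) * C.E 2;
    ∃ Φ : Matrix (Finset (Orb (FermionTorus 2 L))) (TensorIndex (TorusSite 2 M) 2) ℂ,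
      Φᴴ * Φ = 1 ∧
      (∀ Nb : ℕ, Nb ≤ M ^ 2 → ∀ φ : TensorIndex (TorusSite 2 M) 2 → ℂ,
        φ ∈ spinZSector (Λ := TorusSite 2 M) 1 ((Nb : ℝ) - (M : ℝ) ^ 2 / 2) →
        Φ *ᵥ φ ∈ szSector (Λ := FermionTorus 2 L) (L ^ 2 - 2 * Nb) 0 ∧
        Hin *ᵥ (Φ *ᵥ φ) = ((E₀ Nb : ℝ) : ℂ) • (Φ *ᵥ φ)) ∧
      (∀ Nb : ℕ, Nb ≤ M ^ 2 →
        Hin.minEnergyOn (szSector (Λ := FermionTorus 2 L) (L ^ 2 - 2 * Nb) 0) = E₀ Nb ∧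
        ∀ ψ : Fock (Orb (FermionTorus 2 L)), ψ ∈ szSector (Λ := FermionTorus 2 L) (L ^ 2 - 2 * Nb) 0 →
          Hin *ᵥ ψ = ((E₀ Nb : ℝ) : ℂ) • ψ →
          ∃ φ : TensorIndex (TorusSite 2 M) 2 → ℂ,
            φ ∈ spinZSector (Λ := TorusSite 2 M) 1 ((Nb : ℝ) - (M : ℝ) ^ 2 / 2) ∧ ψ = Φ *ᵥ φ) ∧
      (∃ k : ℕ → ℝ, ∀ Nb : ℕ, Nb ≤ M ^ 2 → ∀ φ φ' : TensorIndex (TorusSite 2 M) 2 → ℂ,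
        φ ∈ spinZSector (Λ := TorusSite 2 M) 1 ((Nb : ℝ) - (M : ℝ) ^ 2 / 2) →
        φ' ∈ spinZSector (Λ := TorusSite 2 M) 1 ((Nb : ℝ) - (M : ℝ) ^ 2 / 2) →
        star (Φ *ᵥ φ') ⬝ᵥ ((T * reducedResolvent Hin (E₀ Nb) * T) *ᵥ (Φ *ᵥ φ)) =
          -(star φ' ⬝ᵥ ((((2 * C.J : ℝ) : ℂ) • xxzHamiltonian 1 (torusGraph 2 M) (-1) C.ΔEff +
            ((k Nb : ℝ) : ℂ) • 1) *ᵥ φ))) ∧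
      Φᴴ * pairField dWaveFormFactor L * Φ = ((C.c : ℝ) : ℂ) • ∑ R : TorusSite 2 M, onSite R (spinRaise 1)

/-- **EASY-PLANE CONDENSATE AT THE LOCK-IN ANISOTROPY `Δ_eff(U)`**: the crux hypothesis
`EasyPlaneCondensate` instantiated at `Δ = (plaquettePairCouplings U).ΔEff`, verbatim (every
normalised `N`-boson sector ground state of `xxzHamiltonian 1 (torusGraph 2 M) (-1) Δ_eff(U)` with
`ρM² ≤ N ≤ M²/2` has `c(ρ)·M⁴ ≤ re ⟨ψ, S⁺_tot S⁻_tot ψ⟩`, eventually in even `M`). [folklore] -/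
def BosonCondensateAt (U : ℝ) : Prop :=
  ∀ ρ ∈ Set.Ioc (0:ℝ) (1/2), ∃ c : ℝ, 0 < c ∧ ∃ M₀ : ℕ, ∀ (M : ℕ) [NeZero M], Even M → M₀ ≤ M → ∀ N : ℕ, ρ * (M : ℝ) ^ 2 ≤ (N : ℝ) → 2 * N ≤ M ^ 2 → ∀ (ψ : Literature.MathematicalPhysics.QuantumLattice.TensorIndex (Literature.Probability.LatticeModels.TorusSite 2 M) 2 → ℂ), ψ ∈ Literature.MathematicalPhysics.QuantumLattice.spinZSector (Λ := Literature.Probability.LatticeModels.TorusSite 2 M) 1 ((N : ℝ) - (M : ℝ) ^ 2 / 2) → star ψ ⬝ᵥ ψ = 1 → Matrix.mulVec (Literature.MathematicalPhysics.QuantumLattice.xxzHamiltonian 1 (Literature.Probability.LatticeModels.torusGraph 2 M) (-1) (Literature.MathematicalPhysics.QuantumLattice.plaquettePairCouplings U).ΔEff) ψ = ((Literature.MathematicalPhysics.QuantumLattice.lowestEnergyInSector 1 (Literature.MathematicalPhysics.QuantumLattice.xxzHamiltonian 1 (Literature.Probability.LatticeModels.torusGraph 2 M) (-1) (Literature.MathematicalPhysics.QuantumLattice.plaquettePairCouplings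 U).ΔEff) ((N : ℝ) - (M : ℝ) ^ 2 / 2) : ℝ) : ℂ) • ψ → c * (M : ℝ) ^ 4 ≤ (star ψ ⬝ᵥ Matrix.mulVec ((∑ x : Literature.Probability.LatticeModels.TorusSite 2 M, Literature.MathematicalPhysics.QuantumLattice.onSite x (Literature.MathematicalPhysics.QuantumLattice.spinRaise 1)) * (∑ y : Literature.Probability.LatticeModels.TorusSite 2 M, Literature.MathematicalPhysics.QuantumLattice.onSite y (Literature.MathematicalPhysics.QuantumLattice.spinLower 1))) ψ).re

/-- **THE ANCHOR AT `(U, δ)`**: the consequent of the crux `DressAnyFilling` at a given coupling and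
doping, verbatim — for all `t' ∈ (0, t₀)`, eventually in `L ∈ 4ℕ`, every normalised
`(2⌊(1-δ)L²/2⌋, S^z = 0)`-sector ground state of the checkerboard Hubbard torus
`hamiltonian G_intra 1 U + hamiltonian G_inter t' 0` has `c(t')·L⁴ ≤ re ⟨Δ_d† Δ_d⟩`. [folklore] -/
def AnchorAt (U δ : ℝ) : Prop :=
  ∃ t₀ : ℝ, 0 < t₀ ∧ ∀ t' ∈ Set.Ioo (0:ℝ) t₀, ∃ c : ℝ, 0 < c ∧ ∃ L₀ : ℕ, ∀ (L : ℕ) [NeZero L], L₀ ≤ L → 4 ∣ L → ∀ (N : ℕ) (ψ : Literature.MathematicalPhysics.QuantumLattice.Fock (Literature.MathematicalPhysics.QuantumLattice.Orb (Literature.MathematicalPhysics.QuantumLattice.FermionTorus 2 L))), N = 2 * ⌊(1 - δ) * (L : ℝ) ^ 2 / 2⌋₊ → star ψ ⬝ᵥ ψ = 1 → Literature.MathematicalPhysics.QuantumLattice.IsGroundStateInSector (Literature.MathematicalPhysics.QuantumLattice.hamiltonian ((Literature.MathematicalPhysics.QuantumLattice.fermionTorusGraph 2 L) \ SimpleGraph.comap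 (fun x : Literature.MathematicalPhysics.QuantumLattice.FermionTorus 2 L => fun i : Fin 2 => ((ofLex x) i : ℕ) / 2) ⊤) 1 U + Literature.MathematicalPhysics.QuantumLattice.hamiltonian ((Literature.MathematicalPhysics.QuantumLattice.fermionTorusGraph 2 L) ⊓ SimpleGraph.comap (fun x : Literature.MathematicalPhysics.QuantumLattice.FermionTorus 2 L => fun i : Fin 2 => ((ofLex x) i : ℕ) / 2) ⊤) t' 0) N 0 ψ → c * (L : ℝ) ^ 4 ≤ (Literature.MathematicalPhysics.QuantumLattice.expect ((Literature.MathematicalPhysics.QuantumLattice.pairField Literature.MathematicalPhysics.QuantumLattice.dWaveFormFactor L)ᴴ * Literature.MathematicalPhysics.QuantumLattice.pairField Literature.MathematicalPhysics.QuantumLattice.dWaveFormFactor L) ψ).re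

/-! ## The three stubs -/

/-- **STUB 1 `stub_kineticGlueInWindow` — CERTIFIED PLAQUETTE DATA** (the route's `KineticGlueInWindow`, typed
over the landed `plaquettePairCouplings`): there is a repulsion `U > 0` with `PlaquetteData U` — (W1) window
`0 < J`, `0 ≤ V < 2J`; (W2) `c > 0`; (W3) strict chord condition on the plaquette charge (pair binding, pair
exclusion, no trions, charge-gap side); (W4) uniqueness and (W5) singlet character of the `(4,0)`, `(2,0)`
plaquette ground states. Finite-dimensional; to be settled by certified exact diagonalisation at one
`U ∈ (0, U_s)`, e.g. `U = 2` (route numbers, uncertified: `V/2J = 0.993`). Yao–Tsai–Kivelson 2007, eq. (2)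
and p. 4; Tsai–Kivelson 2006, Table I, App. A. -/
theorem stub_kineticGlueInWindow :
    ∃ U : ℝ, 0 < U ∧ PlaquetteData U := by
  sorry

/-- **STUB 2 `stub_plaquetteDictionary` — THE PLAQUETTE-BOSON DICTIONARY TO SECOND ORDER** (the exact,
finite-dimensional half of the route's `SchriefferWolffPlaquette`): at every coupling carrying the plaquette
data, `PlaquetteDictionary U` — isometric even-parity product embedding, sector and `E₀`-eigenspace, exhaustion
of the `H_in` sector ground space, Kato's second-order kernel `= -(2J·XXZ(Δ_eff) + k(N_b))`, and
`Φᴴ Δ_d Φ = c Σ S⁺`. Tsai–Kivelson 2006, App. A (A1); Yao–Tsai–Kivelson 2007, eq. (2); Kato 1966, II-§2.2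
(2.20); Altman–Auerbach 2002, §II.D. -/
theorem stub_plaquetteDictionary :
    ∀ U : ℝ, 0 < U → PlaquetteData U → PlaquetteDictionary U := by
  sorry

/-- **STUB 3 `stub_dressingStability` — DRESSING** (the route's `DressingStability`; the open, load-bearing
stub): at a coupling `U` with the plaquette data and the second-order dictionary, if the `S = ½` XXZ torus AT
THE LOCKED-IN ANISOTROPY `Δ_eff(U)` has easy-plane condensation at every filling `ρ ∈ (0, 1/2]`
(`BosonCondensateAt U`), then for SOME doping `δ ∈ (0, 1/2)` the anchor holds at `(U, δ)` (`AnchorAt U δ`,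
the crux's consequent at this `U`, verbatim). Content: the `O(t'²)` effective gas is `2J t'² · XXZ(Δ_eff)`
(stub 2); its condensate must survive the extensive `O(t'⁴)` Schrieffer–Wolff remainder for `t' < t₀(U)` and
is seen by `Δ_d` through `|c(U)|² > 0` (W2). No LRO-stability theorem off reflection positivity is known
(Datta–Fernández–Fröhlich 1996 treats gapped phases; Koma–Tasaki 1994 for the obstruction side); this is the
bet of the crux. -/
theorem stub_dressingStability :
    ∀ U : ℝ, 0 < U → PlaquetteData U → PlaquetteDictionary U → BosonCondensateAt U →
      ∃ δ ∈ Set.Ioo (0:ℝ) (1/2), AnchorAt U δ := by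
  sorry

/-! ## Named twins of the stub statements (same text; keyed by the stub names for `#h21_check_skeleton`) -/

/-- Named twin of stub 1 (same text). [folklore] -/
def Sig.stub_kineticGlueInWindow : Prop :=
    ∃ U : ℝ, 0 < U ∧ PlaquetteData U

/-- Named twin of stub 2 (same text). [folklore] -/
def Sig.stub_plaquetteDictionary : Prop :=
    ∀ U : ℝ, 0 < U → PlaquetteData U → PlaquetteDictionary U

/-- Named twin of stub 3 (same text). [folklore] -/
def Sig.stub_dressingStability : Prop :=
    ∀ U : ℝ, 0 < U → PlaquetteData U → PlaquetteDictionary U → BosonCondensateAt U →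
      ∃ δ ∈ Set.Ioo (0:ℝ) (1/2), AnchorAt U δ

/-! ## The composition: the three stubs imply the crux, by name -/

/-- **`DressAnyFilling_of`** — literal shape `stub₁-sig → stub₂-sig → stub₃-sig → DressAnyFilling`, REAL proof
(no `sorry`), concluding the route decl BY NAME. The glue is the route's thesis sentence "the lock-in lands
inside the window": from `0 < J`, `0 ≤ V < 2J` (stub 1) the anisotropy `Δ_eff(U) = -V/(2J)` lies in
`Set.Ioc (-1) 0`, so the crux hypothesis `EasyPlaneCondensate` applies at `Δ_eff(U)` and every
`ρ ∈ (0, 1/2]`; stub 2 gives the dictionary at `U`; stub 3 gives `δ` and the anchor. [folklore] -/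
theorem DressAnyFilling_of (h₁ : Sig.stub_kineticGlueInWindow) (h₂ : Sig.stub_plaquetteDictionary)
    (h₃ : Sig.stub_dressingStability) :
    Summit.HubbardSuperconductivity.HubbardSuperconductivity.Theses.PolyaSchurPairBoson.DressAnyFilling := by
  intro hE
  unfold Sig.stub_kineticGlueInWindow at h₁
  unfold Sig.stub_plaquetteDictionary at h₂
  unfold Sig.stub_dressingStability at h₃
  obtain ⟨U, hU, hPD⟩ := h₁
  -- the window inequalities of the certified plaquette data
  have hW : (0 < (plaquettePairCouplings U).J ∧ 0 ≤ (plaquettePairCouplings U).V ∧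
      (plaquettePairCouplings U).V < 2 * (plaquettePairCouplings U).J) := hPD.1
  obtain ⟨hJ, hV0, hV2⟩ := hW
  -- THE LOCK-IN LANDS INSIDE THE WINDOW: `Δ_eff(U) = -V/(2J) ∈ (-1, 0]`
  have h2J : 0 < 2 * (plaquettePairCouplings U).J := by linarith
  have hΔ : (plaquettePairCouplings U).ΔEff ∈ Set.Ioc (-1 : ℝ) 0 := by
    rw [plaquettePairCouplings_ΔEff, Set.mem_Ioc, neg_div]
    refine ⟨?_, ?_⟩
    · rw [neg_lt_neg_iff, div_lt_one h2J]
      exact hV2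
    · rw [neg_nonpos]
      exact div_nonneg hV0 h2J.le
  -- the crux hypothesis, instantiated at the lock-in anisotropy
  have hB : BosonCondensateAt U := by
    unfold BosonCondensateAt
    exact fun ρ hρ => hE _ hΔ ρ hρ
  -- stub 2: the dictionary at `U`; stub 3: dressing
  obtain ⟨δ, hδ, hA⟩ := h₃ U hU hPD (h₂ U hU hPD) hB
  unfold AnchorAt at hA
  exact ⟨U, hU, δ, hδ, hA⟩

/-- The stubs themselves feed the composition (their statements are the `Sig` twins, syntactically). [folklore] -/
theorem DressAnyFilling_skeleton :
    Summit.HubbardSuperconductivity.HubbardSuperconductivity.Theses.PolyaSchurPairBoson.DressAnyFilling :=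
  DressAnyFilling_of stub_kineticGlueInWindow stub_plaquetteDictionary stub_dressingStability

end Summit.HubbardSuperconductivity.HubbardSuperconductivity.Cruxes.DressAnyFilling.Birth

end
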